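import Literature.AlgebraicGeometry.Frobenioids.UnitLinearIsotropic
import HarnessLib

/-!
# Frobenioids I, Proposition 2.5 (iii): the unit-linear Frobenius functor `Ψ : C ⥲ C(d)` — proof

Mochizuki, *The geometry of Frobenioids I: the general theory*, Kyushu J. Math. **62** (2008)
293–400, §2, Proposition 2.5 (iii) and its proof, kurims text pp. 49–50
[cite: MochizukiFrdI2008, Prop. 2.5(iii) p.49].

Standing data: a Frobenioid `F : C → F_Φ` of Frobenius-normalized, metrically trivial and
`Aut`-ample type, a characteristic splitting `τ`, an endomorphism `δ : Φ → Φ` of the monoid `Φ`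
("multiplication by `d ∈ Λ_{>0}`").  This file finishes the proof of Prop. 2.5 (iii):

> "(iii) There exists an equivalence of categories `Ψ : C ⥲ C(d)` — which we shall refer to as the
> unit-linear Frobenius functor [associated to `τ`, `d`] — that satisfies the following properties:
> (a) `Ψ` acts as the identity on objects and isometries of `C`; (b) `Ψ` is 1-compatible, relative
> to the functors `C → F_Φ`, `C(d) → F_{d·Φ} = (F_Φ)(d) ⊆ F_Φ` with the Frobenius functor
> associated to `d` on `F_Φ`."

Step 3 (p. 50: "since isotropic hulls are monomorphisms [cf. Definition 1.3, (v), (a)], this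
implies [by relating an arbitrary `φ ∈ Arr(C)` to the result of applying the isotropification
functor of Proposition 1.9, (v), to `φ`] that the assignment `φ ↦ Ψ(φ)` is compatible with
composites, for arbitrary `φ ∈ Arr(C)`"): for an arbitrary arrow `φ : A → B` let
`φ^istr : A^istr → B^istr` be its extension to the chosen isotropic hulls; `Ψ(φ)` is THE arrow with
`Ψ(φ) ; h_B = h_A ; Ψ(φ^istr)` (`unitLinearMap`, `unitLinearMap_spec`; `Ψ` on arrows out of isotropic
objects is `unitLinearIstr` of `UnitLinearIsotropic.lean`).  It exists because every `φ` is
`x ; β ; y` with `x, y` isometries and `β ∈ O^▷(A₂)` (Def. 1.3 (iv)(a), (v)(c), metric triviality,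
`Aut`-ampleness), and then `h_A ; Ψ((x ; β ; y)^istr) = x ; Ψ_{A₂}(β) ; y ; h_B` by the compatibility
of `Ψ_{A₂}` with `O^▷(A₂) ↪ O^▷(A₂^istr)` — this is the text's formula
`Ψ(φ) := α ∘ Ψ(β) ∘ γ ∘ δ'`.  Functoriality, faithfulness and fullness then descend from the
isotropic case along the monomorphisms `h_B`.

Results: `unitLinearFrobeniusData` (`Ψ` with (a)), `…_isEquivalence` (for `δ` injective on each
`Φ(A)`: "`Λ` supports `Φ`"), `…_oneCommutes` ((b), identity components), and the discharger
`unitLinearFrobeniusExists (d : ℕ+)` (`Λ = ℤ`, `δ = powEnd Φ d`).  Composition is diagrammatic.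
-/

noncomputable section

namespace Literature.AlgebraicGeometry.Frobenioids

open CategoryTheory Opposite

universe w v v' u u'

/-- In a sharp, integral and saturated monoid the `n`-th power map (`n ≥ 1`) is injective
(FrdI §0 p. 11: the argument showing `M → M^pf` injective). [cite: MochizukiFrdI2008, §0 p.11] -/
theorem pow_left_injective_of_isSharp_isIntegral_isSaturated {M : Type*} [CommMonoid M]
    (h₁ : IsSharp M) (h₂ : IsIntegral M) (h₃ : IsSaturated M) (n : ℕ+) :
    Function.Injective fun a : M => a ^ (n : ℕ) := by
  intro a b hab
  dsimp only at hab
  haveI : IsCancelMul M := isIntegral_iff_isCancelMul.mp h₂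
  have hx : (Algebra.GrothendieckGroup.of a / Algebra.GrothendieckGroup.of b) ^ (n : ℕ) ∈
      Set.range (Algebra.GrothendieckGroup.of (M := M)) :=
    ⟨1, by rw [div_pow, ← map_pow, ← map_pow, hab, div_self', map_one]⟩
  obtain ⟨c, hc⟩ := h₃.1 _ n n.pos hx
  have hac : a = c * b := h₂.1 (by rw [map_mul, hc, div_mul_cancel])
  have hcN : c ^ (n : ℕ) = 1 := by
    have : c ^ (n : ℕ) * b ^ (n : ℕ) = 1 * b ^ (n : ℕ) := by rw [← mul_pow, ← hac, hab, one_mul]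
    exact mul_right_cancel this
  rw [hac, h₁.isTorsionFree.1 c n n.pos hcN, one_mul]

namespace PreFrobenioid

variable {D : Type u} [Category.{v} D] {Φ : Dᵒᵖ ⥤ CommMonCat.{w}}
  {C : Type u'} [Category.{v'} C] {F : C ⥤ ElemFrobenioid Φ}

/-! ### Arrows between chosen isotropic hulls -/

/-- The extension of `f : X → Y` to the chosen hulls is unique (`h_X` is an epimorphism).
[cite: MochizukiFrdI2008, Prop. 1.9(v) p.33] -/
theorem hull_square_unique (hF : IsFrobenioid F) {X Y : C} {f : X ⟶ Y}
    {g g' : hullObj hF X ⟶ hullObj hF Y} (hg : hullHom hF X ≫ g = f ≫ hullHom hF Y)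
    (hg' : hullHom hF X ≫ g' = f ≫ hullHom hF Y) : g = g' := by
  haveI := hF.isPreFrobenioid.isTotallyEpimorphic.epi (hullHom hF X)
  exact (cancel_epi (hullHom hF X)).mp (hg.trans hg'.symm)

/-- `Div` along hull squares: `Base(h_X)^* Div(f^istr) = Div(f)`.
[cite: MochizukiFrdI2008, Prop. 1.9(v) p.33] -/
theorem pull_div_hull_square (hF : IsFrobenioid F) {X Y : C} {f : X ⟶ Y}
    {g : hullObj hF X ⟶ hullObj hF Y} (hg : hullHom hF X ≫ g = f ≫ hullHom hF Y) :
    pull Φ (Base F (hullHom hF X)) (Div F g) = Div F f := by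
  have hhX := isIsotropicHull_hullHom hF X
  have hhY := isIsotropicHull_hullHom hF Y
  have hd := congrArg (Div F) hg
  rw [div_comp, div_comp, show Div F (hullHom hF X) = 1 from hhX.1, one_pow, mul_one,
    show Div F (hullHom hF Y) = 1 from hhY.1, map_one, one_mul,
    show degFr F (hullHom hF Y) = 1 from hhY.2.1.1, PNat.one_coe, pow_one] at hd
  exact hd

/-- Isometries extend to isometries of the hulls. [cite: MochizukiFrdI2008, Prop. 1.9(v) p.33] -/
theorem isIsometry_hull_square (hF : IsFrobenioid F) {X Y : C} {f : X ⟶ Y}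
    {g : hullObj hF X ⟶ hullObj hF Y} (hg : hullHom hF X ≫ g = f ≫ hullHom hF Y)
    (hf : IsIsometry F f) : IsIsometry F g := by
  haveI : IsIso (Base F (hullHom hF X)) := (isIsotropicHull_hullHom hF X).2.1.2
  apply pull_injective_of_isIso Φ (Base F (hullHom hF X))
  rw [pull_div_hull_square hF hg, map_one]
  exact hf

/-- `deg_Fr` along hull squares. [cite: MochizukiFrdI2008, Prop. 1.9(v) p.33] -/
theorem degFr_hull_square (hF : IsFrobenioid F) {X Y : C} {f : X ⟶ Y}
    {g : hullObj hF X ⟶ hullObj hF Y} (hg : hullHom hF X ≫ g = f ≫ hullHom hF Y) :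
    degFr F g = degFr F f := by
  have hd := congrArg (degFr F) hg
  rw [degFr_comp, degFr_comp, show degFr F (hullHom hF X) = 1 from (isIsotropicHull_hullHom hF X).2.1.1,
    show degFr F (hullHom hF Y) = 1 from (isIsotropicHull_hullHom hF Y).2.1.1, one_mul, mul_one] at hd
  exact hd

/-- `Base` along hull squares. [cite: MochizukiFrdI2008, Prop. 1.9(v) p.33] -/
theorem base_hull_square {X Y : C} {f : X ⟶ Y} {hF : IsFrobenioid F}
    {g : hullObj hF X ⟶ hullObj hF Y} (hg : hullHom hF X ≫ g = f ≫ hullHom hF Y) :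
    Base F (hullHom hF X) ≫ Base F g = Base F f ≫ Base F (hullHom hF Y) := by
  rw [← base_comp, hg, base_comp]

/-! ### Every arrow is `x ; β ; y` with `x, y` isometries -/

/-- **Isometric factorisation**: in a Frobenioid of metrically trivial and `Aut`-ample type every
arrow `φ : A → B` is `x ; β ; y` with `x` an isometric base-isomorphism (Frobenius-type part followed
by the isometric pre-step part, Def. 1.3 (iv)(a), (v)(c)), `β ∈ O^▷(A₂)` (the co-angular pre-step
part, turned into a base-identity endomorphism by metric triviality and `Aut`-ampleness) and `y` a
linear isometry (automorphism followed by the pull-back part) — the text's `φ = α ∘ β ∘ γ ∘ δ'`.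
[cite: MochizukiFrdI2008, Prop. 2.5(iii) p.49] -/
theorem exists_isometric_factorization (hF : IsFrobenioid F) (hmt : IsOfType (IsMetricallyTrivial F))
    (haa : IsOfType (IsAutAmple F)) {A B : C} (φ : A ⟶ B) :
    ∃ (A₂ : C) (x : A ⟶ A₂) (β : endSubmonoid F A₂) (y : A₂ ⟶ B), IsIsometry F x ∧ IsBaseIso F x ∧
      IsIsometry F y ∧ IsLinear F y ∧ x ≫ (β.1 : A₂ ⟶ A₂) ≫ y = φ := by
  have hP := hF.isPreFrobenioid
  obtain ⟨X, Y, γ, p, α₀, hfac, hγ, hp, hα₀⟩ := hF.iv_a_exists φ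
  obtain ⟨A₂, γ', c, hfac', ⟨hγ'i, hγ'p⟩, hc⟩ := hF.v_c_exists p hp
  obtain ⟨f₀⟩ := hmt A₂ c hc.1 hc.2
  obtain ⟨a, ha⟩ := haa A₂ (@asIso D _ _ _ (Base F (c ≫ f₀.hom))
    (IsBaseIso.comp F hc.2.2 (isBaseIso_of_isIso F f₀.hom)))
  have hab : Base F a.hom = Base F (c ≫ f₀.hom) := congrArg Iso.hom ha
  obtain ⟨⟨-, hα₀i⟩, hα₀l⟩ := hF.iv_b α₀ hα₀
  refine ⟨A₂, γ ≫ γ', ⟨(c ≫ f₀.hom) ≫ a.inv, ?_, ?_⟩, a.hom ≫ f₀.inv ≫ α₀,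
    IsIsometry.comp F hγ.1.2 hγ'i, IsBaseIso.comp F hγ.2 hγ'p.2, ?_, ?_, ?_⟩
  · show Base F ((c ≫ f₀.hom) ≫ a.inv) = 𝟙 _
    rw [base_comp, ← hab, ← base_comp, a.hom_inv_id, base_id]
  · exact IsLinear.comp F (IsLinear.comp F hc.2.1 (isLinear_of_isIso F f₀.hom)) (isLinear_of_isIso F a.inv)
  · exact IsIsometry.comp F (isIsometry_of_isIso F hP a.hom)
      (IsIsometry.comp F (isIsometry_of_isIso F hP f₀.inv) hα₀i)
  · exact IsLinear.comp F (isLinear_of_isIso F a.hom) (IsLinear.comp F (isLinear_of_isIso F f₀.inv) hα₀l)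
  · show (γ ≫ γ') ≫ (((c ≫ f₀.hom) ≫ a.inv) ≫ a.hom ≫ f₀.inv ≫ α₀) = φ
    simp only [Category.assoc, Iso.inv_hom_id_assoc, Iso.hom_inv_id_assoc]
    rw [← hfac, ← hfac', Category.assoc]

namespace CharacteristicSplitting

variable (hF : IsFrobenioid F) (τ : CharacteristicSplitting F) (hmt : IsOfType (IsMetricallyTrivial F))
  (haa : IsOfType (IsAutAmple F)) (δ : Φ ⟶ Φ) (hnorm : IsOfType (IsFrobeniusNormalized F))

include hnorm

/-! ### The key computation: `h_A ; Ψ((x ; β ; y)^istr) = x ; Ψ_{A₂}(β) ; y ; h_B` -/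

/-- For `φ = x ; β ; y` with `x, y` isometries and `β ∈ O^▷(A₂)`:
`h_A ; Ψ(φ^istr) = x ; Ψ_{A₂}(β) ; y ; h_B` (`φ^istr = x^istr ; O^▷(h)(β) ; y^istr`; `Ψ` is
compatible with composites on arrows out of isotropic objects, the identity on the isometries
`x^istr, y^istr`, and `Ψ_{A₂^istr}(O^▷(h)(β)) = O^▷(h)(Ψ_{A₂}(β))`).
[cite: MochizukiFrdI2008, Prop. 2.5(iii) p.50] -/
theorem hullHom_comp_unitLinearIstr {A A₂ B : C} {x : A ⟶ A₂} (hx : IsIsometry F x)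
    (β : endSubmonoid F A₂) {y : A₂ ⟶ B} (hy : IsIsometry F y)
    {g : hullObj hF A ⟶ hullObj hF B}
    (hg : hullHom hF A ≫ g = (x ≫ (β.1 : A₂ ⟶ A₂) ≫ y) ≫ hullHom hF B) :
    hullHom hF A ≫ unitLinearIstr hF τ hmt haa δ (isIsotropicHull_hullHom hF A).2.2.1 g =
      (x ≫ ((unitLinearPow hF τ hmt haa δ A₂ β).1 : A₂ ⟶ A₂) ≫ y) ≫ hullHom hF B := by
  have hhA := isIsotropicHull_hullHom hF A
  have hh₂ := isIsotropicHull_hullHom hF A₂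
  obtain ⟨gx, hgx, -⟩ := exists_hull_square hF x
  obtain ⟨gy, hgy, -⟩ := exists_hull_square hF y
  have hm := hullMap_spec hh₂ β
  dsimp only at hm
  -- `g = x^istr ; O^▷(h)(β) ; y^istr`
  have hg' : g = gx ≫ ((hullMap hh₂ β).1 : _ ⟶ _) ≫ gy := by
    apply hull_square_unique hF hg
    rw [reassoc_of% hgx, reassoc_of% hm, hgy]
    simp only [Category.assoc]
  rw [hg', unitLinearIstr_comp hF τ hmt haa δ hnorm hhA.2.2.1, unitLinearIstr_comp hF τ hmt haa δ hnorm,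
    unitLinearIstr_of_isIsometry hF τ hmt haa δ _ (isIsometry_hull_square hF hgx hx),
    unitLinearIstr_of_isIsometry hF τ hmt haa δ _ (isIsometry_hull_square hF hgy hy),
    unitLinearIstr_endSubmonoid, ← hullMap_unitLinearPow]
  have hm' := hullMap_spec hh₂ (unitLinearPow hF τ hmt haa δ A₂ β)
  dsimp only at hm'
  rw [reassoc_of% hgx, reassoc_of% hm', hgy]
  simp only [Category.assoc]

/-! ### `Ψ` on arbitrary arrows -/

/-- Existence of `Ψ(φ)`: an arrow `ψ` with `ψ ; h_B = h_A ; Ψ(φ^istr)` (through an isometric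
factorisation of `φ`). [cite: MochizukiFrdI2008, Prop. 2.5(iii) p.50] -/
theorem exists_unitLinearMap {A B : C} (φ : A ⟶ B) :
    ∃ (ψ : A ⟶ B) (g : hullObj hF A ⟶ hullObj hF B), hullHom hF A ≫ g = φ ≫ hullHom hF B ∧
      ψ ≫ hullHom hF B = hullHom hF A ≫ unitLinearIstr hF τ hmt haa δ (isIsotropicHull_hullHom hF A).2.2.1 g := by
  obtain ⟨A₂, x, β, y, hx, -, hy, -, hfac⟩ := exists_isometric_factorization hF hmt haa φ
  obtain ⟨g, hg, -⟩ := exists_hull_square hF φ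
  refine ⟨x ≫ ((unitLinearPow hF τ hmt haa δ A₂ β).1 : A₂ ⟶ A₂) ≫ y, g, hg, ?_⟩
  rw [hullHom_comp_unitLinearIstr hF τ hmt haa δ hnorm hx β hy (by rw [hg, hfac])]

/-- **`Ψ(φ)`** for an arbitrary arrow `φ : A → B`: the arrow with `Ψ(φ) ; h_B = h_A ; Ψ(φ^istr)`.
[cite: MochizukiFrdI2008, Prop. 2.5(iii) p.50] -/
def unitLinearMap {A B : C} (φ : A ⟶ B) : A ⟶ B :=
  (exists_unitLinearMap hF τ hmt haa δ hnorm φ).choose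

/-- The defining square of `Ψ(φ)`: `Ψ(φ) ; h_B = h_A ; Ψ(φ^istr)` for ANY extension `φ^istr` of `φ`
to the hulls. [cite: MochizukiFrdI2008, Prop. 2.5(iii) p.50] -/
theorem unitLinearMap_spec {A B : C} {φ : A ⟶ B} {g : hullObj hF A ⟶ hullObj hF B}
    (hg : hullHom hF A ≫ g = φ ≫ hullHom hF B) :
    unitLinearMap hF τ hmt haa δ hnorm φ ≫ hullHom hF B =
      hullHom hF A ≫ unitLinearIstr hF τ hmt haa δ (isIsotropicHull_hullHom hF A).2.2.1 g := by
  obtain ⟨g₀, hg₀, h⟩ := (exists_unitLinearMap hF τ hmt haa δ hnorm φ).choose_spec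
  rw [hull_square_unique hF hg hg₀]
  exact h

/-- **The text's formula** `Ψ(φ) = α ∘ Ψ(β) ∘ γ ∘ δ'`: for `φ = x ; β ; y` with `x, y` isometries,
`Ψ(φ) = x ; Ψ_{A₂}(β) ; y` — in particular `Ψ(φ)` is independent of the factorisation.
[cite: MochizukiFrdI2008, Prop. 2.5(iii) p.49] -/
theorem unitLinearMap_eq_of_factorization {A A₂ B : C} {x : A ⟶ A₂} (hx : IsIsometry F x)
    (β : endSubmonoid F A₂) {y : A₂ ⟶ B} (hy : IsIsometry F y) :
    unitLinearMap hF τ hmt haa δ hnorm (x ≫ (β.1 : A₂ ⟶ A₂) ≫ y) =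
      x ≫ ((unitLinearPow hF τ hmt haa δ A₂ β).1 : A₂ ⟶ A₂) ≫ y := by
  obtain ⟨g, hg, -⟩ := exists_hull_square hF (x ≫ (β.1 : A₂ ⟶ A₂) ≫ y)
  haveI := hF.v_a (hullHom hF B) (isIsotropicHull_hullHom hF B).2.1
  rw [← cancel_mono (hullHom hF B), unitLinearMap_spec hF τ hmt haa δ hnorm hg,
    hullHom_comp_unitLinearIstr hF τ hmt haa δ hnorm hx β hy hg]

/-- **`Ψ` is compatible with composites** for arbitrary arrows (descends from the isotropic case
along the monomorphism `h_{B'}`). [cite: MochizukiFrdI2008, Prop. 2.5(iii) p.50] -/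
theorem unitLinearMap_comp {A B B' : C} (φ : A ⟶ B) (φ' : B ⟶ B') :
    unitLinearMap hF τ hmt haa δ hnorm (φ ≫ φ') =
      unitLinearMap hF τ hmt haa δ hnorm φ ≫ unitLinearMap hF τ hmt haa δ hnorm φ' := by
  obtain ⟨g, hg, -⟩ := exists_hull_square hF φ
  obtain ⟨g', hg', -⟩ := exists_hull_square hF φ'
  have hgg' : hullHom hF A ≫ (g ≫ g') = (φ ≫ φ') ≫ hullHom hF B' := by
    rw [reassoc_of% hg, hg', Category.assoc]
  haveI := hF.v_a (hullHom hF B') (isIsotropicHull_hullHom hF B').2.1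
  rw [← cancel_mono (hullHom hF B'), Category.assoc, unitLinearMap_spec hF τ hmt haa δ hnorm hgg',
    unitLinearIstr_comp hF τ hmt haa δ hnorm, unitLinearMap_spec hF τ hmt haa δ hnorm hg',
    reassoc_of% (unitLinearMap_spec hF τ hmt haa δ hnorm hg)]

/-- `Ψ(id) = id`. [cite: MochizukiFrdI2008, Prop. 2.5(iii) p.49] -/
theorem unitLinearMap_id (A : C) : unitLinearMap hF τ hmt haa δ hnorm (𝟙 A) = 𝟙 A := by
  haveI := hF.v_a (hullHom hF A) (isIsotropicHull_hullHom hF A).2.1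
  rw [← cancel_mono (hullHom hF A), unitLinearMap_spec hF τ hmt haa δ hnorm (g := 𝟙 _)
    (by rw [Category.comp_id, Category.id_comp]), unitLinearIstr_of_isIsometry hF τ hmt haa δ _
    (isIsometry_of_isIso F hF.isPreFrobenioid _), Category.comp_id, Category.id_comp]

/-- **(a) `Ψ` is the identity on isometries.** [cite: MochizukiFrdI2008, Prop. 2.5(iii) p.49] -/
theorem unitLinearMap_of_isIsometry {A B : C} {φ : A ⟶ B} (hφ : IsIsometry F φ) :
    unitLinearMap hF τ hmt haa δ hnorm φ = φ := by
  obtain ⟨g, hg, -⟩ := exists_hull_square hF φ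
  haveI := hF.v_a (hullHom hF B) (isIsotropicHull_hullHom hF B).2.1
  rw [← cancel_mono (hullHom hF B), unitLinearMap_spec hF τ hmt haa δ hnorm hg,
    unitLinearIstr_of_isIsometry hF τ hmt haa δ _ (isIsometry_hull_square hF hg hφ), hg]

/-- `Base(Ψ(φ)) = Base(φ)`. [cite: MochizukiFrdI2008, Prop. 2.5(iii) p.49] -/
theorem base_unitLinearMap {A B : C} (φ : A ⟶ B) :
    Base F (unitLinearMap hF τ hmt haa δ hnorm φ) = Base F φ := by
  obtain ⟨g, hg, -⟩ := exists_hull_square hF φ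
  haveI : IsIso (Base F (hullHom hF B)) := (isIsotropicHull_hullHom hF B).2.1.2
  rw [← cancel_mono (Base F (hullHom hF B)), ← base_comp, unitLinearMap_spec hF τ hmt haa δ hnorm hg,
    base_comp, base_unitLinearIstr, base_hull_square hg]

/-- `deg_Fr(Ψ(φ)) = deg_Fr(φ)`. [cite: MochizukiFrdI2008, Prop. 2.5(iii) p.49] -/
theorem degFr_unitLinearMap {A B : C} (φ : A ⟶ B) :
    degFr F (unitLinearMap hF τ hmt haa δ hnorm φ) = degFr F φ := by
  obtain ⟨g, hg, -⟩ := exists_hull_square hF φ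
  have hd := congrArg (degFr F) (unitLinearMap_spec hF τ hmt haa δ hnorm hg)
  rw [degFr_comp, degFr_comp, degFr_unitLinearIstr, degFr_hull_square hF hg,
    show degFr F (hullHom hF A) = 1 from (isIsotropicHull_hullHom hF A).2.1.1,
    show degFr F (hullHom hF B) = 1 from (isIsotropicHull_hullHom hF B).2.1.1, one_mul, mul_one] at hd
  exact hd

/-- **`Div(Ψ(φ)) = d · Div(φ)`** — (b): `Ψ` is compatible with the Frobenius functor on `F_Φ`.
[cite: MochizukiFrdI2008, Prop. 2.5(iii) p.49] -/
theorem div_unitLinearMap {A B : C} (φ : A ⟶ B) :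
    Div F (unitLinearMap hF τ hmt haa δ hnorm φ) = (δ.app (op (baseObj F A))).hom (Div F φ) := by
  obtain ⟨g, hg, -⟩ := exists_hull_square hF φ
  have hhA := isIsotropicHull_hullHom hF A
  have hhB := isIsotropicHull_hullHom hF B
  have hd := congrArg (Div F) (unitLinearMap_spec hF τ hmt haa δ hnorm hg)
  rw [div_comp, div_comp, show Div F (hullHom hF B) = 1 from hhB.1, map_one, one_mul,
    show degFr F (hullHom hF B) = 1 from hhB.2.1.1, PNat.one_coe, pow_one,
    show Div F (hullHom hF A) = 1 from hhA.1, one_pow, mul_one, div_unitLinearIstr, ← end_app_pull,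
    pull_div_hull_square hF hg] at hd
  exact hd

/-- `Ψ(φ)` lies in `C(d)`. [cite: MochizukiFrdI2008, Prop. 2.5(iii) p.49] -/
theorem div_unitLinearMap_mem {A B : C} (φ : A ⟶ B) :
    divIn F δ (unitLinearMap hF τ hmt haa δ hnorm φ) :=
  ⟨Div F φ, (div_unitLinearMap hF τ hmt haa δ hnorm φ).symm⟩

/-- **`Ψ` is faithful** when `δ` is injective (descends from `unitLinearIstr_injective`).
[cite: MochizukiFrdI2008, Prop. 2.5(iii) p.50] -/
theorem unitLinearMap_injective (hδ : ∀ A : Dᵒᵖ, Function.Injective (δ.app A).hom) {A B : C}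
    {φ φ' : A ⟶ B} (h : unitLinearMap hF τ hmt haa δ hnorm φ = unitLinearMap hF τ hmt haa δ hnorm φ') :
    φ = φ' := by
  obtain ⟨g, hg, -⟩ := exists_hull_square hF φ
  obtain ⟨g', hg', -⟩ := exists_hull_square hF φ'
  haveI := hF.isPreFrobenioid.isTotallyEpimorphic.epi (hullHom hF A)
  haveI := hF.v_a (hullHom hF B) (isIsotropicHull_hullHom hF B).2.1
  have h1 : hullHom hF A ≫ unitLinearIstr hF τ hmt haa δ (isIsotropicHull_hullHom hF A).2.2.1 g =
      hullHom hF A ≫ unitLinearIstr hF τ hmt haa δ (isIsotropicHull_hullHom hF A).2.2.1 g' := by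
    rw [← unitLinearMap_spec hF τ hmt haa δ hnorm hg, ← unitLinearMap_spec hF τ hmt haa δ hnorm hg', h]
  have h2 : g = g' := unitLinearIstr_injective hF τ hmt haa δ _ (hδ _) ((cancel_epi _).mp h1)
  rw [← cancel_mono (hullHom hF B), ← hg, ← hg', h2]

/-- **`Ψ` is full onto `C(d)`**: every `ψ` with `Div(ψ) ∈ d · Φ` is `Ψ(φ)` (factor `ψ = x ; β ; y`;
then `Div(β) ∈ d · Φ(A₂)`, so `β = Ψ_{A₂}(β')`, and `φ := x ; β' ; y`).
[cite: MochizukiFrdI2008, Prop. 2.5(iii) p.50] -/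
theorem exists_unitLinearMap_eq {A B : C} {ψ : A ⟶ B} (hψ : divIn F δ ψ) :
    ∃ φ : A ⟶ B, unitLinearMap hF τ hmt haa δ hnorm φ = ψ := by
  obtain ⟨A₂, x, β, y, hx, hxb, hy, hyl, hfac⟩ := exists_isometric_factorization hF hmt haa ψ
  haveI : IsIso (Base F x) := hxb
  -- `Div(ψ) = Base(x)^* Div(β)`
  have hdiv : Div F ψ = pull Φ (Base F x) (divHom F A₂ β) := by
    rw [← hfac, div_comp, div_comp, show Div F x = 1 from hx, one_pow, mul_one,
      show Base F (β.1 : A₂ ⟶ A₂) = 𝟙 _ from β.2.1, pull_id, show Div F y = 1 from hy, one_mul,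
      show degFr F y = 1 from hyl, PNat.one_coe, pow_one, divHom_apply]
  have hβ : divHom F A₂ β ∈ imageSubmonoid δ (op (baseObj F A₂)) := by
    have h1 : divHom F A₂ β = pull Φ (inv (Base F x)) (Div F ψ) := by
      rw [hdiv, ← pull_comp, IsIso.inv_hom_id, pull_id]
    rw [h1]
    exact pull_mem_imageSubmonoid δ _ hψ
  obtain ⟨β', hβ'⟩ := exists_unitLinearPow_eq hF τ hmt haa δ hβ
  exact ⟨x ≫ (β'.1 : A₂ ⟶ A₂) ≫ y, by
    rw [unitLinearMap_eq_of_factorization hF τ hmt haa δ hnorm hx β' hy, hβ', hfac]⟩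

/-! ### The unit-linear Frobenius functor -/

/-- **The unit-linear Frobenius functor `Ψ : C → C(d)`** (as `UnitLinearFrobeniusData`: identity on
objects and isometries, values in `C(d)`). [cite: MochizukiFrdI2008, Prop. 2.5(iii) p.49] -/
def unitLinearFrobeniusData : UnitLinearFrobeniusData F δ where
  map φ := unitLinearMap hF τ hmt haa δ hnorm φ
  map_mem φ := div_unitLinearMap_mem hF τ hmt haa δ hnorm φ
  map_id A := unitLinearMap_id hF τ hmt haa δ hnorm A
  map_comp φ ψ := unitLinearMap_comp hF τ hmt haa δ hnorm φ ψ
  map_isometry _ hφ := unitLinearMap_of_isIsometry hF τ hmt haa δ hnorm hφ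

/-- **`Ψ : C → C(d)` is an equivalence of categories** when `δ` is injective on each `Φ(A)` (the
residue of "`Λ` supports `Φ`"): "it is clear from the definition of `Ψ`, `C(d)` that `Ψ` is
essentially surjective, faithful, and full [cf. assertion (i)]" (p. 50).
[cite: MochizukiFrdI2008, Prop. 2.5(iii) p.50] -/
theorem unitLinearFrobeniusData_isEquivalence (hδ : ∀ A : Dᵒᵖ, Function.Injective (δ.app A).hom) :
    (unitLinearFrobeniusData hF τ hmt haa δ hnorm).functor.IsEquivalence := by
  haveI : (unitLinearFrobeniusData hF τ hmt haa δ hnorm).functor.Faithful := ⟨fun {A B} φ φ' h =>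
    unitLinearMap_injective hF τ hmt haa δ hnorm hδ (congrArg InducedWideCategory.Hom.hom h)⟩
  haveI : (unitLinearFrobeniusData hF τ hmt haa δ hnorm).functor.Full := ⟨fun {A B} ψ => by
    obtain ⟨φ, hφ⟩ := exists_unitLinearMap_eq hF τ hmt haa δ hnorm ψ.2
    exact ⟨φ, InducedWideCategory.Hom.ext hφ⟩⟩
  haveI : (unitLinearFrobeniusData hF τ hmt haa δ hnorm).functor.EssSurj :=
    ⟨fun B => ⟨B.obj, ⟨Iso.refl _⟩⟩⟩
  exact {}

/-- **(b) `Ψ` is `1`-compatible** (in fact with identity components) relative to `C → F_Φ`,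
`C(d) → F_{d·Φ} ⊆ F_Φ` with the Frobenius functor `F_Φ → F_Φ` associated to `δ`: `Base` and `deg_Fr`
are unchanged and `Div` is multiplied by `δ`. [cite: MochizukiFrdI2008, Prop. 2.5(iii) p.49] -/
theorem unitLinearFrobeniusData_oneCommutes :
    OneCommutes (unitLinearFrobeniusData hF τ hmt haa δ hnorm).functor
      (wideSubcategoryInclusion (divIn F δ) ⋙ F) F (ElemFrobenioid.mapEnd δ) := by
  refine ⟨NatIso.ofComponents (fun A => Iso.refl _) fun {A B} φ => ?_⟩
  have key : F.map (unitLinearMap hF τ hmt haa δ hnorm φ) = (ElemFrobenioid.mapEnd δ).map (F.map φ) :=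
    ElemFrobenioid.Hom.ext (base_unitLinearMap hF τ hmt haa δ hnorm φ)
      (div_unitLinearMap hF τ hmt haa δ hnorm φ) (degFr_unitLinearMap hF τ hmt haa δ hnorm φ)
  show F.map (unitLinearMap hF τ hmt haa δ hnorm φ) ≫ 𝟙 (F.obj B) =
    𝟙 (F.obj A) ≫ (ElemFrobenioid.mapEnd δ).map (F.map φ)
  rw [Category.comp_id]
  exact key.trans (Category.id_comp _).symm

end CharacteristicSplitting

/-! ### Proposition 2.5 (iii): the named statement -/

/-- "Multiplication by `d ∈ ℕ_{≥1}`" is injective on every `Φ(A)` of a pre-Frobenioid (`Φ(A)` is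
divisorial: sharp, integral, saturated) — `Λ = ℤ` supports `Φ`, Def. 2.4 (ii)(a).
[cite: MochizukiFrdI2008, Def. 2.4(ii) p.48] -/
theorem powEnd_app_injective (hP : IsPreFrobenioid Φ F) (d : ℕ+) (A : Dᵒᵖ) :
    Function.Injective ((powEnd Φ d).app A).hom := by
  have hΦ := hP.isDivisorial (unop A)
  intro a b hab
  exact pow_left_injective_of_isSharp_isIntegral_isSaturated hΦ.isSharp hΦ.isPreDivisorial.isIntegral
    hΦ.isPreDivisorial.isSaturated d hab

/-- **Prop. 2.5 (iii)** (`Λ = ℤ`, `d ∈ ℕ_{≥1}`, `δ = powEnd Φ d`): for every characteristic splitting `τ`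
on a Frobenioid of Frobenius-normalized, metrically trivial and `Aut`-ample type "there exists an
equivalence of categories `Ψ : C ⥲ C(d)` — the unit-linear Frobenius functor — that satisfies …
(a) `Ψ` acts as the identity on objects and isometries of `C`; (b) `Ψ` is 1-compatible … with the
Frobenius functor associated to `d` on `F_Φ`" — the named statement `UnitLinearFrobeniusExists F d`.
[cite: MochizukiFrdI2008, Prop. 2.5(iii) p.49] -/
theorem unitLinearFrobeniusExists (d : ℕ+) : UnitLinearFrobeniusExists F d :=
  fun τ hF hnorm hmt haa =>
    ⟨CharacteristicSplitting.unitLinearFrobeniusData hF τ hmt haa (powEnd Φ d) hnorm,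
      CharacteristicSplitting.unitLinearFrobeniusData_isEquivalence hF τ hmt haa (powEnd Φ d) hnorm
        (powEnd_app_injective hF.isPreFrobenioid d),
      CharacteristicSplitting.unitLinearFrobeniusData_oneCommutes hF τ hmt haa (powEnd Φ d) hnorm⟩

end PreFrobenioid

end Literature.AlgebraicGeometry.Frobenioids
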